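import Summits.BirchSwinnertonDyer.BirchSwinnertonDyer.Theorems.KimAtThreeDeepLowerOffStratumLevelLoweringMultiStabDepleteRows
import HarnessLib

/-!
# Route `KimAtThreeKolyvagin` (rung W2), crux `DeepLowerAtThreeOffKatoStratum` (item 19679), registered
# stub `stub_nonAdditive`, ROAD (b^k,add): the (LL₁) CERTIFICATE of gen 7's ★⁹ (Tamagawa `3` at a split multiplicative
# prime, dropping additive places), cut before the consumer

Cell `bsd-addord`, seat `bsd-addord-w2-acc2`, gen 8; item `stmt-BirchSwinnertonDyer-19679` (`--supports`, closes
nothing). Gen 7's ★⁹ (`…MultiStabDepleteRows.stub_nonAdditive_ram_of_exists_levelLoweredNewform_deplete`) ends with THEOREM A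
and then the (ram) consumer (Skinner 2016 Thm. C needs `Ram W₀ 3`). THIS FILE re-runs ★⁹'s proof VERBATIM up to THEOREM A and
returns the certificate `IsStabilisedLevelLoweringCongruenceIn W₀ 3 1 D₀.f q π` itself (★⁹ᵃ), so that other consumers — gen
2's COVERED consumer («(ram) only if `3` is multiplicative», Yan–Zhu binder, PRE-tier) in `…MultiStabDepleteClassCovered` —
can be applied to the same rows (gen 8's census: 392 good-ordinary no-(ram) (M) rows). Only the THEOREM-A-side binders are
kept (tower-surjective `W₀`, `N` = conductor, `D₀`, `3`-integral plus symbols, `¬Addv`); FOUR named facts `hCE hV hGV hI`.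
Theorems only; nothing booked; BSD is not proved by any of this.

* ★⁹ᵃ `isStabilisedLevelLoweringCongruenceIn_of_exists_levelLoweredNewform_deplete`.
[cite: Vatsal1999, §1 (1.6), Thm. (1.13)] [cite: GreenbergVatsal2000, §3 (17)–(19)] [cite: Ribet1984ICM, Thm. 4.1]
[cite: ColemanEdixhoven1998, Thm. 2.1] [cite: AtkinLehner1970, Thm. 3, Thm. 5] [cite: Knapp1993, Thm. 9.27]
-/

set_option autoImplicit false
-- the Theorems namespace of a single-conjunct summit repeats the summit name by design (D-0017)
set_option linter.dupNamespace false

noncomputable section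

open scoped MatrixGroups ModularForm Classical NNReal

open CongruenceSubgroup WeierstrassCurve Literature.NumberTheory.EllipticCurves
  Literature.NumberTheory.EllipticCurves.ModularForms

namespace Summit.BirchSwinnertonDyer.BirchSwinnertonDyer.Theorems.KimAtThreeDeepLowerOffStratumLevelLoweringMultiStabDepleteCertificate

open Summit.BirchSwinnertonDyer.Rank1Residual Summit.BirchSwinnertonDyer.Rank1Residual.LevelLowering
open Summit.BirchSwinnertonDyer.BirchSwinnertonDyer.Theorems.KimAtThreeDeepLowerSmallDefect
open Summit.BirchSwinnertonDyer.BirchSwinnertonDyer.Theorems.KimAtThreeDeepLowerNonAdditiveRows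
open Summit.BirchSwinnertonDyer.BirchSwinnertonDyer.Theorems.KimAtThreeShallowEqDeepOffStratumNonAdditiveRows
open Summit.BirchSwinnertonDyer.BirchSwinnertonDyer.Theorems.KimAtThreeDeepLowerOffStratumSockets
open Summit.BirchSwinnertonDyer.BirchSwinnertonDyer.Theorems.KimAtThreeDeepLowerOffStratumNonAdditiveRows
open Summit.BirchSwinnertonDyer.BirchSwinnertonDyer.Theorems.KimAtThreeDeepLowerOffStratumLevelLoweringBridge
open Summit.BirchSwinnertonDyer.BirchSwinnertonDyer.Theorems.KimAtThreeDeepLowerOffStratumLevelLoweringRekey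
open Summit.BirchSwinnertonDyer.BirchSwinnertonDyer.Theorems.KimAtThreeDeepLowerOffStratumLevelLoweringVatsal
open Summit.BirchSwinnertonDyer.BirchSwinnertonDyer.Theorems.KimAtThreeDeepLowerOffStratumLevelLoweringVatsalRows
open Summit.BirchSwinnertonDyer.BirchSwinnertonDyer.Theorems.KimAtThreeDeepLowerOffStratumLevelLoweringVatsalStab
open Summit.BirchSwinnertonDyer.BirchSwinnertonDyer.Theorems.KimAtThreeDeepLowerOffStratumLevelLoweringVatsalStabRows
open Summit.BirchSwinnertonDyer.BirchSwinnertonDyer.Theorems.KimAtThreeDeepLowerOffStratumLevelLoweringConditionOne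
open Summit.BirchSwinnertonDyer.BirchSwinnertonDyer.Theorems.KimAtThreeDeepLowerOffStratumLevelLoweringNonEisensteinPrime
open Summit.BirchSwinnertonDyer.BirchSwinnertonDyer.Theorems.KimAtThreeDeepLowerOffStratumLevelLoweringRibetRows
open Summit.BirchSwinnertonDyer.BirchSwinnertonDyer.Theorems.KimAtThreeDeepLowerOffStratumLevelLoweringStabEigenform
  renaming heckeT_stab_of_ne → heckeT_stab_of_ne_eig, heckeT_stab_self → heckeT_stab_self_eig,
    isHeckeEigenform_stab → isHeckeEigenform_stab_eig, cuspCoeff_stab_prime → cuspCoeff_stab_prime_eig,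
    cuspCoeff_mul_cuspCoeff → cuspCoeff_mul_cuspCoeff_eig, heckeEigenvalue_stab → heckeEigenvalue_stab_eig,
    valuation_cuspCoeff_stab_le_one → valuation_cuspCoeff_stab_le_one_eig,
    finiteDimensional_coeffField_stab → finiteDimensional_coeffField_stab_eig
open Summit.BirchSwinnertonDyer.BirchSwinnertonDyer.Theorems.KimAtThreeDeepLowerOffStratumLevelLoweringStabEigenform (smul_plusSymbol_of_heckeT)
open Summit.BirchSwinnertonDyer.BirchSwinnertonDyer.Theorems.KimAtThreeDeepLowerOffStratumLevelLoweringDoubleStabData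
open Summit.BirchSwinnertonDyer.BirchSwinnertonDyer.Theorems.KimAtThreeDeepLowerOffStratumLevelLoweringMultiStabConditionOne
open Summit.BirchSwinnertonDyer.BirchSwinnertonDyer.Theorems.KimAtThreeDeepLowerOffStratumLevelLoweringMultiStabPeriodAnyLevel
open Summit.BirchSwinnertonDyer.BirchSwinnertonDyer.Theorems.KimAtThreeDeepLowerOffStratumLevelLoweringMultiStabIhara
open Summit.BirchSwinnertonDyer.BirchSwinnertonDyer.Theorems.KimAtThreeDeepLowerOffStratumLevelLoweringMultiStabData
open Summit.BirchSwinnertonDyer.BirchSwinnertonDyer.Theorems.KimAtThreeDeepLowerOffStratumLevelLoweringMultiDepleteData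
open Summit.BirchSwinnertonDyer.BirchSwinnertonDyer.Theorems.KimAtThreeDeepLowerOffStratumLevelLoweringMultiStabRowsRam
open Literature.NumberTheory.EllipticCurves.Rank1Residual Literature.NumberTheory.EllipticCurves.Rank1Residual.Typed
  Literature.NumberTheory.EllipticCurves.Skinner2016 Literature.NumberTheory.Automorphic

open Summit.BirchSwinnertonDyer.BirchSwinnertonDyer.Theorems.KimAtThreeDeepLowerOffStratumLevelLoweringMultiStabDepleteRows

/-! ### ★⁹ᵃ The (LL₁) certificate at a split multiplicative Tamagawa-`3` prime (DROP rows) -/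

section Certificate

/-- ★⁹ᵃ **THE (LL₁) CERTIFICATE AT A SPLIT MULTIPLICATIVE TAMAGAWA-`3` PRIME `q`, with DROPPING additive places** —
gen 7's ★⁹ (`…MultiStabDepleteRows.stub_nonAdditive_ram_of_exists_levelLoweredNewform_deplete`) cut BEFORE the (ram) consumer:
same row data (`M₁·D·A·q = N`, `q` split multiplicative, `q ∤ M₁DA`, `D`, `A` squarefree …, the primes of `A` dividing `M₁`
once with `a_p(f_E) = 0`, signs on `D`, the existence of the optimal-level newform `g ∈ S₂(Γ₀(M₁))` congruent off `DqA`
with the Tate clause on `Dq`), but only the THEOREM-A-side binders (tower-surjective `W₀`, `N` = conductor, `D₀`,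
`3`-integral plus symbols, `¬Addv`), and the conclusion is the certificate `IsStabilisedLevelLoweringCongruenceIn W₀ 3 1 D₀.f q π`
itself; FOUR named facts (`hCE hV hGV hI`). Proof verbatim = ★⁹'s up to THEOREM A.
[cite: Vatsal1999, §1 (1.6), Thm. (1.13)] [cite: GreenbergVatsal2000, §3 (17)–(19)] [cite: Ribet1984ICM, Thm. 4.1]
[cite: ColemanEdixhoven1998, Thm. 2.1] [cite: AtkinLehner1970, Thm. 3, Thm. 5] [cite: Knapp1993, Thm. 9.27] -/
theorem isStabilisedLevelLoweringCongruenceIn_of_exists_levelLoweredNewform_deplete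
    (hCE : colemanEdixhoven1998_heckePolynomial_simpleRoots)
    (hV : vatsal1999_plusSymbol_congruence) (hGV : greenbergVatsal2000_plusSymbol_congruence)
    (hI : ribet1984_iharaLemma) :
    ∀ (W₀ : WeierstrassCurve ℚ) [W₀.IsElliptic] [W₀.IsGloballyMinimal],
      (∀ n : ℕ, W₀.HasSurjectiveModNGaloisRep (3 ^ n : ℕ)) →
      ∀ {N : ℕ} [NeZero N], N = W₀.conductorNorm ℤ →
      ∀ (D₀ : ModularParametrizationData W₀ N),
        (∀ r : ℚ, ratPlusSymbol D₀.f r ≠ 0 → 0 ≤ padicValRat 3 (ratPlusSymbol D₀.f r)) →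
        ¬ (haveI : Fact (Nat.Prime 3) := ⟨Nat.prime_three⟩; Addv W₀ 3) →
        ∀ {M₁ D A q : ℕ} [NeZero M₁] [Fact q.Prime], M₁ * D * A * q = N →
        W₀.HasSplitMultiplicativeReductionAtPrime q → ¬ q ∣ M₁ * D * A → Squarefree D → Nat.Coprime D M₁ →
        Squarefree A → Nat.Coprime A D →
        (∀ ℓ : ℕ, ℓ.Prime → ℓ ∣ A → ℓ ∣ M₁ ∧ ¬ ℓ ^ 2 ∣ M₁ ∧ cuspCoeff D₀.f ℓ = 0) →
        (∀ p : ℕ, p.Prime → p ∣ D → ∃ u : ℤ, u * u = 1 ∧ cuspCoeff D₀.f p = u) →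
        (∀ ι : PadicAlgCl 3 ≃+* ℂ, ∃ g : CuspForm (Gamma0 M₁) 2, IsNewform0 g ∧
          (∀ p : ℕ, p.Prime → ¬ p ∣ D * q * A → Valued.v (ι.symm (cuspCoeff D₀.f p - cuspCoeff g p)) < 1) ∧
          (∀ p : ℕ, p.Prime → p ∣ D * q → Valued.v (ι.symm (cuspCoeff g p - cuspCoeff D₀.f p * (p + 1))) < 1)) →
        ∃ π : ZMod 3 →+* IsLocalRing.ResidueField (Valued.integer (PadicAlgCl 3)),
          IsStabilisedLevelLoweringCongruenceIn W₀ 3 1 D₀.f q π := by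
  intro W₀ _ _ htower N _ hN D₀ hint hnA M₁ D A q _ _ hMDq hsplit hqMD hDsq hDM₁
    hAsq hAD hA hsign hex
  subst hMDq
  have hq : q.Prime := Fact.out
  haveI : NeZero q := ⟨hq.ne_zero⟩
  haveI : NeZero D := ⟨Squarefree.ne_zero hDsq⟩
  haveI : NeZero A := ⟨Squarefree.ne_zero hAsq⟩
  have hqM₁D : ¬ q ∣ M₁ * D := fun h ↦ hqMD (h.mul_right A)
  have hqM₁ : ¬ q ∣ M₁ := fun h ↦ hqM₁D (h.mul_right D)
  have hqD : ¬ q ∣ D := fun h ↦ hqM₁D (h.mul_left M₁)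
  have hqA : ¬ q ∣ A := fun h ↦ hqMD (h.mul_left (M₁ * D))
  set ι : PadicAlgCl 3 ≃+* ℂ := Classical.choice (PadicAlgCl.nonempty_ringEquiv_complex 3) with hι
  obtain ⟨g, hg, hcp, hrem⟩ := hex ι
  have hf := D₀.isNewformOf
  have hfq : cuspCoeff D₀.f q = 1 := by
    rw [hf.2 q, lFunction_eq_one_of_hasSplitMultiplicativeReductionAtPrime W₀ q hsplit, Int.cast_one]
  -- the `k`-fold stabilisation `G₁` of `g` at the primes of `D` (level `M₁ D`)
  obtain ⟨G₁, hG₁eig, hG₁norm, hG₁int, hG₁fd, hG₁C, hG₁g, hG₁f, hG₁span⟩ :=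
    exists_multiStab hg ι (fun p ↦ cuspCoeff D₀.f p) hCE D hDsq hDM₁
      (fun p hp hpD ↦ by
        obtain ⟨u, hu, hfu⟩ := hsign p hp hpD
        refine ⟨u, hu, hfu, ?_⟩
        have h := hrem p hp (hpD.mul_right q)
        rwa [hfu] at h)
      (M₁ * D) rfl
  -- the `k`-fold depletion `G` of `G₁` at the primes of `A` (level `M₁ D A`); `a_ℓ(g) = ±1 ≠ 0` at `ℓ ∥ M₁`
  have hAat : ∀ ℓ : ℕ, ℓ.Prime → ℓ ∣ A → ℓ ∣ M₁ ∧ cuspCoeff g ℓ ≠ 0 := by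
    intro ℓ hℓ hℓA
    obtain ⟨hℓM, hℓ2, -⟩ := hA ℓ hℓ hℓA
    refine ⟨hℓM, fun h0 ↦ ?_⟩
    have h1 := hg.cuspCoeff_sq_eq_one_of_dvd_of_not_sq_dvd hℓ hℓM hℓ2
    rw [h0] at h1
    norm_num at h1
  obtain ⟨G, hGeig, hGnorm, hGint, hGfd, hGC, hGg, hGf, hGz, hGspan⟩ :=
    exists_multiDeplete hg ι (fun p ↦ cuspCoeff D₀.f p) hG₁eig hG₁norm hG₁int hG₁fd hG₁C hG₁g hG₁f hG₁span A hAsq hAD hAat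
      (M₁ * D * A) rfl
  have hGp : ∀ {p : ℕ}, p.Prime → ¬ p ∣ M₁ * D * A → cuspCoeff G p = cuspCoeff g p :=
    fun {p} hp hpL ↦ hGg p hp fun h ↦ hpL (by rw [mul_assoc]; exact h.mul_left M₁)
  -- the root `β ≡ q` at `q`, `α ≠ β` (Coleman–Edixhoven)
  have hGq : cuspCoeff G q = cuspCoeff g q := hGg q hq fun h ↦ by
    rcases (Nat.Prime.dvd_mul hq).mp h with h | h
    · exact hqD h
    · exact hqA h
  have haq : Valued.v (ι.symm (cuspCoeff G q - (q + 1))) < 1 := by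
    have h := hrem q hq (dvd_mul_left q D)
    rwa [hfq, one_mul, ← hGq] at h
  obtain ⟨β, hβ, hβq⟩ := exists_root_valuation_sub_lt_one ι (hGint q) q haq
  have hne : cuspCoeff G q - β ≠ β :=
    colemanEdixhoven1998_heckePolynomial_simpleRoots.root_ne hCE hg hq hqM₁ (by rw [← hGq]; exact sub_add_cancel _ β)
      (by linear_combination -hβ)
  obtain ⟨hα1, hc⟩ := valuation_div_sub_one_lt_one ι hq hβ haq hβq
  -- the comparison form `h = ι₁ G − β ι_q G` at level `M₁ D A q = N`
  have hq₁ : M₁ * D * A * 1 ∣ M₁ * D * A * q := mul_dvd_mul_left _ (one_dvd q)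
  have hqq : M₁ * D * A * q ∣ M₁ * D * A * q := dvd_rfl
  set h := iota (M₁ * D * A) (M₁ * D * A * q) 1 2 hq₁ G - β • iota (M₁ * D * A) (M₁ * D * A * q) q 2 hqq G with hhdef
  have heig : IsHeckeEigenform h := isHeckeEigenform_stab_eig hGeig hGnorm β hq₁ hqq hq hqMD hβ
  have hnorm : IsNormalized h := isNormalized_stab G β hq₁ hqq hGnorm hq
  have hhint : ∀ n, Valued.v (ι.symm (cuspCoeff h n)) ≤ 1 := valuation_cuspCoeff_stab_le_one_eig ι β hq₁ hqq hGint hβ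
  have hhfd : FiniteDimensional ℚ (coeffField h) := finiteDimensional_coeffField_stab_eig β hq₁ hqq hGfd hβ
  have hhC : HasSimpleHeckeGenEigenspace h :=
    hasSimpleHeckeGenEigenspace_stab_of_hasSimpleHeckeGenEigenspace hg hq₁ hqq
      (by rw [mul_assoc]; exact dvd_mul_right M₁ (D * A)) hGeig hGnorm hGC (fun p hp hpL ↦ hGp hp hpL) hq hqMD hβ hne
  have hfC : HasSimpleHeckeGenEigenspace D₀.f := hasSimpleHeckeGenEigenspace_of_isNewform0 hf.1
  -- congruence of ALL coefficients, from the primes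
  have hcong : ∀ n : ℕ, Valued.v (ι.symm (cuspCoeff D₀.f n - cuspCoeff h n)) < 1 := by
    refine valuation_cuspCoeff_sub_lt_one_of_prime ι hf.1.2.1 heig hf.1.2.2 hnorm
      (valuation_cuspCoeff_le_one_of_isNewformOf W₀ hf ι) hhint fun p hp ↦ ?_
    rw [hhdef, cuspCoeff_stab_prime_eig hGnorm β hq₁ hqq hq hp]
    by_cases hpq : p = q
    · subst hpq
      rw [if_pos rfl, hfq]
      have : ι.symm (1 - (cuspCoeff G p - β)) = -ι.symm (cuspCoeff G p - β - 1) := by rw [← map_neg]; congr 1; ring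
      rw [this, Valuation.map_neg]; exact hα1
    · rw [if_neg hpq]
      by_cases hpD : p ∣ D
      · exact hGf p hp hpD
      · by_cases hpA : p ∣ A
        · rw [(hA p hp hpA).2.2, hGz p hp hpA, sub_self, map_zero, Valuation.map_zero]
          exact zero_lt_one
        · have hpDqA : ¬ p ∣ D * q * A := fun h' ↦ by
            rcases (Nat.Prime.dvd_mul hp).mp h' with h' | h'
            · rcases (Nat.Prime.dvd_mul hp).mp h' with h' | h'
              · exact hpD h'
              · exact hpq ((Nat.prime_dvd_prime_iff_eq hp hq).mp h')
            · exact hpA h'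
          have hpDA : ¬ p ∣ D * A := fun h' ↦ by
            rcases (Nat.Prime.dvd_mul hp).mp h' with h' | h'
            · exact hpD h'
            · exact hpA h'
          rw [hGg p hp hpDA]; exact hcp p hp hpDqA
  -- the OLD SHAPE data `(Φ, c, b) = (plusSymbol G, β/q, a_·(g))`
  have hshape : ∀ x : ℚ, plusSymbol h x = plusSymbol G x - β / q * plusSymbol G (q * x) :=
    fun x ↦ plusSymbol_stab G β hq₁ hqq x
  have hΦper : ∀ x : ℚ, plusSymbol G (x + 1) = plusSymbol G x := by
    intro x
    have e₁ := modularSymbol_add_intCast_holds G x 1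
    have e₂ := modularSymbol_add_intCast_holds G (-x) (-1)
    simp only [plusSymbol]
    rw [show -(x + 1) = -x + ((-1 : ℤ) : ℚ) by push_cast; ring, e₂, show x + 1 = x + ((1 : ℤ) : ℚ) by push_cast; ring, e₁]
  have hLN : ∀ {p : ℕ}, ¬ p ∣ W₀.conductorNorm ℤ → ¬ p ∣ M₁ * D * A := fun hpN h' ↦ hpN (hN ▸ h'.mul_right q)
  have hDqAN : ∀ {p : ℕ}, ¬ p ∣ W₀.conductorNorm ℤ → ¬ p ∣ D * q * A := fun hpN h' ↦
    hpN (hN ▸ h'.trans ⟨M₁, by ring⟩)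
  have hb : ∀ p : ℕ, p.Prime → ¬ p ∣ W₀.conductorNorm ℤ * 3 →
      Valued.v (ι.symm (cuspCoeff g p - (W₀.frobeniusTrace p : ℂ))) < 1 := by
    intro p hp hpN3
    haveI : Fact p.Prime := ⟨hp⟩
    have hpN : ¬ p ∣ W₀.conductorNorm ℤ := fun h' ↦ hpN3 (h'.mul_right 3)
    have hfp : cuspCoeff D₀.f p = (W₀.frobeniusTrace p : ℂ) := by
      rw [hf.2 p, LFunction_apply_prime_eq_frobeniusTrace W₀ p (hasGoodReductionAtPrime_of_not_dvd_conductorNorm W₀ hpN)]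
    rw [← hfp, ← Valuation.map_neg, ← map_neg, neg_sub]
    exact hcp p hp (hDqAN hpN)
  have hTG : ∀ (p : ℕ) (hp : p.Prime), ¬ p ∣ M₁ * D * A →
      (haveI : NeZero p := ⟨hp.ne_zero⟩; heckeT (Gamma0 (M₁ * D * A)) 2 p G) = cuspCoeff g p • G := by
    intro p hp hpL
    haveI : NeZero p := ⟨hp.ne_zero⟩
    rw [heckeT_eq_heckeEigenvalue_smul G p (hGeig p hp), heckeEigenvalue_eq_coeff_of_isNormalized hGnorm hp (hGeig p hp),
      ← hGp hp hpL]
    rfl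
  have hΦhecke : ∀ p : ℕ, p.Prime → ¬ p ∣ W₀.conductorNorm ℤ * 3 → ∀ x : ℚ,
      cuspCoeff g p * plusSymbol G x = (∑ j : Fin p, plusSymbol G ((x + j) / p)) + plusSymbol G (p * x) := by
    intro p hp hpN3 x
    haveI : NeZero p := ⟨hp.ne_zero⟩
    have hpL : ¬ p ∣ M₁ * D * A := hLN fun h' ↦ hpN3 (h'.mul_right 3)
    exact smul_plusSymbol_of_heckeT p hp hpL (hTG p hp hpL) x
  -- the numeral `r₀ ≡ 1 (mod N)` by Chebotarev, and the unit `a_{r₀}(g) − r₀ − 1`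
  have hsurj : W₀.HasSurjectiveModNGaloisRep ((3 : ℕ) : ℤ) := by simpa only [pow_one] using htower 1
  obtain ⟨r₀, hr₀, -, hr₀S, -, hr₀1, hE₀⟩ := exists_prime_one_mod_not_dvd_frobeniusTrace_sub W₀ hsurj (M₁ * D * A * q)
  haveI : Fact r₀.Prime := ⟨hr₀⟩
  have hr₀L : ¬ r₀ ∣ M₁ * D * A := fun h' ↦ hr₀S (h'.mul_right q)
  have hr₀1L : r₀ ≡ 1 [MOD M₁ * D * A] := hr₀1.of_mul_right q
  have hr₀N : ¬ r₀ ∣ W₀.conductorNorm ℤ := by rwa [← hN]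
  have hfr₀ : cuspCoeff D₀.f r₀ = (W₀.frobeniusTrace r₀ : ℂ) := by
    rw [hf.2 r₀, LFunction_apply_prime_eq_frobeniusTrace W₀ r₀ (hasGoodReductionAtPrime_of_not_dvd_conductorNorm W₀ hr₀N)]
  have hunit : Valued.v (ι.symm (cuspCoeff g r₀ - (r₀ + 1))) = 1 := by
    refine valuation_cuspCoeff_sub_eq_one_of_congr ι hE₀ ?_
    rw [← hfr₀]; exact hcp r₀ hr₀ (hDqAN hr₀N)
  -- the real structure of `G`: `G = Σ cᵢ φᵢ`, `φᵢ` real with `T_r φᵢ = a_r(g) φᵢ` (`r ∤ M₁DA`)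
  obtain ⟨n, c, φ, hGsum⟩ := Submodule.mem_span_set'.mp hGspan
  have hreal : ∀ i m, (cuspCoeff (φ i : CuspForm (Gamma0 (M₁ * D * A)) 2) m).im = 0 := fun i ↦ (φ i).2.1
  have hφT : ∀ (i : Fin n) (r : ℕ) (hr : r.Prime), ¬ r ∣ M₁ * D * A * q →
      (haveI : NeZero r := ⟨hr.ne_zero⟩; heckeT (Gamma0 (M₁ * D * A)) 2 r (φ i : CuspForm (Gamma0 (M₁ * D * A)) 2)) =
        cuspCoeff g r • (φ i : CuspForm (Gamma0 (M₁ * D * A)) 2) :=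
    fun i r hr hrS ↦ (φ i).2.2 r hr fun h' ↦ hrS (h'.mul_right q)
  have he : ∀ r : ℕ, r.Prime → ¬ r ∣ M₁ * D * A * q → IsIntegral ℤ (cuspCoeff g r) ∧ (cuspCoeff g r).im = 0 :=
    fun r _ _ ↦ ⟨IsNewform0.isIntegral_coeff_holds hg r, hg.cuspCoeff_im_eq_zero r⟩
  -- the period producer at ANY level: `plusSymbol h ≢ 0 ⟹ Ψ ≢ 0 ⟹ Ω ⟹ x₀ (Ihara)`
  have hΩ : (∃ x : ℚ, plusSymbol h x ≠ 0) →
      ∃ Ω : ℂ, (∀ x : ℚ, Valued.v (ι.symm (plusSymbol G x / Ω)) ≤ 1) ∧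
        ∃ x₀ : ℚ, Valued.v (ι.symm ((plusSymbol G x₀ - β / q * plusSymbol G (q * x₀)) / Ω)) = 1 := by
    rintro ⟨x, hx⟩
    have hne0 : ∃ y : ℚ, plusSymbol (∑ i, c i • (φ i : CuspForm (Gamma0 (M₁ * D * A)) 2)) y ≠ 0 := by
      by_contra hall
      push Not at hall
      rw [hGsum] at hall
      exact hx (by rw [hshape, hall, hall, mul_zero, sub_zero])
    have hTsum := hTG r₀ hr₀ hr₀L
    rw [← hGsum] at hTsum
    obtain ⟨Ω, hΩint, γ₀, hγ₀, hΩu⟩ := exists_period_integral_unit_cycle_sum_smul_of_one_mod (c := c) ι hreal hne0 hr₀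
      hr₀L hr₀1L (valuation_cuspCoeff_le_one_of_isNewform0 hg ι r₀) hTsum hunit
    obtain ⟨x₀, hx₀⟩ := exists_valuation_stabilisedSymbol_eq_one_sum_smul_of_ribet1984_iharaLemma hI hq hqMD hφT he hreal
      c ι hΩint γ₀ hγ₀ hΩu hr₀ hr₀S hr₀1 hunit hc
    rw [hGsum] at hΩint hx₀
    exact ⟨Ω, hΩint, x₀, hx₀⟩
  -- THEOREM A (with producer)
  exact isStabilisedLevelLoweringCongruenceIn_three_of_not_addv_of_exists_period hV hGV W₀ htower hN D₀ hint hnA ι h q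
    hfC heig hnorm hhfd hhint hhC hcong (plusSymbol G) (β / q) (fun p ↦ cuspCoeff g p) hshape hc hΦper hb hΦhecke hΩ


end Certificate

end Summit.BirchSwinnertonDyer.BirchSwinnertonDyer.Theorems.KimAtThreeDeepLowerOffStratumLevelLoweringMultiStabDepleteCertificate

end
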